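import Literature.NumberTheory.EllipticCurves.PeriodIndexCorestriction
import HarnessLib

/-!
# Restriction along a finite-index subgroup pair `H₁ ≤ H₂ ≤ Γ`: «`res_{H₁} η = 0 ⟹ [H₂ : H₁] • η = 0`»
# — (ET) piece A plumbing (crux `SplitBadTwoRankOneOfFacts`, stmt-BirchSwinnertonDyer-20368;
# TURNKEY-20368-ET-w3g10 §2 (A))

Cell `bsd-print-cf2`, width seat `bsd-line-cf2-p1-w2` gen 12 (helper for the étale brick (ET) of
-w3 g10 / -w8 g3, which feeds (FIN)/(BF) of S3b′-v11).  Pure continuous group cohomology.  The tree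
already has Serre I §2.4 Prop. 9 in degree one for a subgroup `N` of the AMBIENT group
(`Literature.NumberTheory.EllipticCurves.index_nsmul_eq_zero_of_resSubgroupH1_eq_zero`:
`resSubgroupH1 N M η = 0 ⟹ N.index • η = 0`, and the index-`2` transfer form
`two_nsmul_eq_zero_of_resSubgroupH1_eq_zero`).  The (ET) brick works with a PAIR of subgroups
`H₁ ≤ H₂` of `Γ_K` (`H₂ = ⊤ ⊓ decomp w`, `H₁ = D_L`, `L = K_w(√d)`, `[D_w : D_L] = 2`) and the tree's
restriction `resOfLe M (h : H₁ ≤ H₂) : H¹(H₂, M) → H¹(H₁, M)`; this file supplies the plumbing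
`resOfLe ↔ resSubgroupH1 (H₁.subgroupOf H₂)` (same pair up to the homeomorphism
`↥(H₁.subgroupOf H₂) ≃ ↥H₁`) and the packaged statements:

* `resSubgroupH1_subgroupOf_eq_zero_of_resOfLe_eq_zero`;
* **`index_nsmul_eq_zero_of_resOfLe_eq_zero`** — `resOfLe M h η = 0 ⟹ (H₁.subgroupOf H₂).index • η = 0`
  (`H₁` open in `↥H₂`, finite index);
* **`two_nsmul_eq_zero_of_resOfLe_eq_zero_of_index_two`** — index `2`: `2 • η = 0`.

Theorems only; no definition, no named fact, no `sorry`, no instance.  HONEST FRAMING: generic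
plumbing; closes nothing by itself (`--supports`); no summit statement / BSD / the crux is proved here.

References: [SerreGaloisCohomology1997] I §2.4 Prop. 9 (`Cor ∘ Res = (G : N)`); [NeukirchSchmidtWingberg2008]
I §5 (Cor. 1.5.7); [GreenbergLNM1716] §2 (pp. 62–63).
-/

noncomputable section

open scoped Classical

set_option linter.dupNamespace false -- `Summit.BirchSwinnertonDyer.BirchSwinnertonDyer` (summit = problem) is the tree's layout

namespace Summit.BirchSwinnertonDyer.BirchSwinnertonDyer.Theorems.PrintCf2.IndexTwoRes

open Literature.NumberTheory.EllipticCurves Literature.NumberTheory.GaloisRepresentations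

universe u

variable {G : Type u} [Group G] [TopologicalSpace G] [IsTopologicalGroup G]
  {M : Type u} [AddCommGroup M] [DistribMulAction G M] [TopologicalSpace M] [DiscreteTopology M]
  {H₁ H₂ : Subgroup G} (h : H₁ ≤ H₂)

omit [IsTopologicalGroup G] [TopologicalSpace M] [DiscreteTopology M] in
/-- `Subgroup.subgroupOfEquivOfLe h : ↥(H₁.subgroupOf H₂) ≃* ↥H₁` is continuous. [folklore] -/
theorem continuous_subgroupOfEquivOfLe : Continuous (Subgroup.subgroupOfEquivOfLe h) := by
  refine Topology.IsInducing.subtypeVal.continuous_iff.mpr ?_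
  show Continuous fun g : H₁.subgroupOf H₂ ↦ ((g : H₂) : G)
  exact continuous_subtype_val.comp continuous_subtype_val

omit [IsTopologicalGroup G] [TopologicalSpace M] [DiscreteTopology M] in
/-- The inclusion `↥(H₁.subgroupOf H₂) → ↥H₂` factors through `↥H₁` (`Subgroup.subgroupOfEquivOfLe`),
continuously. [folklore] -/
theorem subgroupInclusion_comp_subgroupOfEquiv :
    (subgroupInclusion h).comp
        (⟨(Subgroup.subgroupOfEquivOfLe h).toMonoidHom, continuous_subgroupOfEquivOfLe h⟩ :
          H₁.subgroupOf H₂ →ₜ* H₁) =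
      subgroupIncl (H₁.subgroupOf H₂) := by
  refine ContinuousMonoidHom.ext fun x ↦ ?_
  rfl

/-- **Restriction to `H₁ ≤ H₂` and restriction to the subgroup `H₁.subgroupOf H₂` of `↥H₂` agree**
(same pair up to the homeomorphism `↥(H₁.subgroupOf H₂) ≃ ↥H₁`): if `resOfLe M h η = 0` then
`resSubgroupH1 (H₁.subgroupOf H₂) M η = 0`. [cite: SerreGaloisCohomology1997, Ch. I §2.4] -/
theorem resSubgroupH1_subgroupOf_eq_zero_of_resOfLe_eq_zero (η : subgroupH1 H₂ M)
    (hη : resOfLe M h η = 0) : resSubgroupH1 (H₁.subgroupOf H₂) M η = 0 := by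
  -- the homeomorphic identification `e : ↥(H₁.subgroupOf H₂) →ₜ* ↥H₁`
  let e : H₁.subgroupOf H₂ →ₜ* H₁ :=
    ⟨(Subgroup.subgroupOfEquivOfLe h).toMonoidHom, continuous_subgroupOfEquivOfLe h⟩
  have key : resSubgroupH1 (H₁.subgroupOf H₂) M =
      (resH1Hom e (AddMonoidHom.id M) (fun _ _ ↦ rfl)).comp (resOfLe M h) := by
    rw [resOfLe, resH1Hom_comp]
    exact (resH1Hom_congr (subgroupInclusion_comp_subgroupOfEquiv h) (AddMonoidHom.id_comp _) _ _).symm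
  rw [key, AddMonoidHom.comp_apply, hη, map_zero]

/-- **`res_{H₁} η = 0 ⟹ [H₂ : H₁] • η = 0`** for `η ∈ H¹(H₂, M)` (`subgroupH1 H₂ M`), `H₁ ≤ H₂ ≤ G`
with `H₁` OPEN and of finite index in `↥H₂` — Serre I §2.4 Prop. 9 in degree one (the tree's
`index_nsmul_eq_zero_of_resSubgroupH1_eq_zero`, `Cor ∘ Res = (H₂ : H₁)`) read through `resOfLe`.
[cite: SerreGaloisCohomology1997, Ch. I §2.4, Prop. 9] -/
theorem index_nsmul_eq_zero_of_resOfLe_eq_zero [Fintype (H₂ ⧸ H₁.subgroupOf H₂)]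
    (hopen : IsOpen ((H₁.subgroupOf H₂ : Subgroup H₂) : Set H₂))
    (η : subgroupH1 H₂ M) (hη : resOfLe M h η = 0) : (H₁.subgroupOf H₂).index • η = 0 :=
  index_nsmul_eq_zero_of_resSubgroupH1_eq_zero (H₁.subgroupOf H₂) hopen
    (resSubgroupH1_subgroupOf_eq_zero_of_resOfLe_eq_zero h η hη)

/-- **Index `2`: `res_{H₁} η = 0 ⟹ 2 • η = 0`** — the (ET) brick's last step at `H₂ = D_w`,
`H₁ = D_L`, `L = K_w(√d)`, `[D_w : D_L] = 2`, `M = W*`, `η` the `e`-component of a Kummer class on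
`D_w`. [cite: SerreGaloisCohomology1997, Ch. I §2.4, Prop. 9] [cite: GreenbergLNM1716, §2 (pp. 62–63)] -/
theorem two_nsmul_eq_zero_of_resOfLe_eq_zero_of_index_two
    (hopen : IsOpen ((H₁.subgroupOf H₂ : Subgroup H₂) : Set H₂))
    (hidx : (H₁.subgroupOf H₂).index = 2)
    (η : subgroupH1 H₂ M) (hη : resOfLe M h η = 0) : 2 • η = 0 := by
  haveI : Fintype (H₂ ⧸ H₁.subgroupOf H₂) :=
    Subgroup.fintypeOfIndexNeZero (by rw [hidx]; decide)
  rw [← hidx]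
  exact index_nsmul_eq_zero_of_resOfLe_eq_zero h hopen η hη

end Summit.BirchSwinnertonDyer.BirchSwinnertonDyer.Theorems.PrintCf2.IndexTwoRes

end
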